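import Summits.AtomisticToContinuum.Crystallization.Theorems.FrustratedLawDichotomyTextureCoarseTransfer
import Summits.AtomisticToContinuum.Crystallization.Theorems.FrustratedLawDichotomyTextureUniformVerdict

/-!
# FrustratedLawDichotomy · crux `AperiodicFrustratedLawGap` (stmt-AtomisticToContinuum-27623) — (FLIP), BAD verdict: a coherent window over a
# bad-with-margin template makes the matched textured sites NOT `1/8`-good (decomp-a2c lens-5 g111; critic r1702 (B)(3)(b), r1712 (C5), r1713 (D))

Companion of `…TextureFlipGood`.  The template site `x₁` whose ball holds the atom matched to the site `k` is BAD WITH MARGIN in the SOFT form the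
tree engine `…TextureFineShells.shell_transfer_core` produces: for NO scale `dk ≥ 7/10` and NO linear isometry `A` is the template around `x₁`
softly `1/8`-matched to the fcc (resp. hcp) pattern with slack `σ + 2τ` («every pattern point `dk•A u` has a template point within `dk/8 + σ + 2τ` of
`x₁ + dk•A u`, and every template point `z ≠ x₁` with `dist z x₁ + σ + 4τ ≤ 13/10·dk` is within `dk/8 + σ + 2τ` of some `x₁ + dk•A u`»).  The FINITE
bad rows of a host net (`n_T ≠ 12`, or shell tolerance above the `1/8` collar) are turned into this certificate by a separate row lemma (owed).

* ★ `not_gy_eighth_of_badTemplate` — one site: `shell_transfer_core` + transport along the coherent window ⇒ `¬ Gy (1/8) N y k`.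
* ★ `forall_not_gy_eighth_of_uniformBadTemplate` — uniformly bad template ⇒ no site within `ρ` of `y i` is `1/8`-good: the second disjunct of
  `hflip`'s conclusion (`…TextureIncoherence.exists_incoherent_atom_of_apprM`, `R' := 0`).
[folklore] throughout; no definitions, no `sorry`, no instances, no notation.
-/

noncomputable section

namespace Summit.AtomisticToContinuum.Crystallization.Theorems.FrustratedLawDichotomyTextureFlipBad

open Metric Set
open Literature.Geometry.DiscreteGeometry
open Summit.AtomisticToContinuum.Crystallization.Theorems.RepetitiveNetworkReductionRecurrentMember (Gy TexBall ApprM)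

/-- ★ **(FLIP), BAD direction.**  Same coherent-window data; the site `k` of `y` (within `ρ` of `y i`) is matched to the atom `p' ∈ S` in the
ball of the template site `x₁`, and `x₁` is BAD WITH MARGIN in the SOFT form the tree engine `shell_transfer_core` produces: for NO scale
`dk ≥ 7/10` and NO linear isometry `A` is the template around `x₁` softly `(1/8)`-matched to the fcc (resp. hcp) pattern with slack `σ + 2τ`
(«every pattern point `dk•A u` has a template point within `dk/8 + σ + 2τ` of `x₁ + dk•A u`, and every template point `z ≠ x₁` with
`dist z x₁ + σ + 4τ ≤ 13/10·dk` is within `dk/8 + σ + 2τ` of some `x₁ + dk•A u`»).  Then `y k` is NOT `1/8`-good.  Numerics: `0 < σ`, `2ε' < δ`,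
`4ε' ≤ σ` (`ε'` the matching tolerance), template `2τ`-separated, a template neighbour `z₁` of `x₁` at distance `≤ d₁` (so the shell scale of `k`
is `≤ B := d₁ + 2τ + 2ε'`), `13/10·B + B + ρ + 1 ≤ R`, `d₁ + 2τ + ρ + ε' ≤ R`, window `‖x₁‖ + τ + 9/8·B + σ ≤ Rc`.
(`shell_transfer_core` + transport along the coherent window.) [folklore] -/
theorem not_gy_eighth_of_badTemplate
    {S : Set (EuclideanSpace ℝ (Fin 3))} {δ : ℝ} (hS : ∀ x ∈ S, ∀ x' ∈ S, x ≠ x' → δ ≤ dist x x')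
    {a : Finset (EuclideanSpace ℝ (Fin 3))} {τ Rc : ℝ} (hτ : 0 ≤ τ)
    (ha : ∀ z ∈ a, ∀ z' ∈ a, z ≠ z' → 2 * τ < dist z z')
    (hC1 : ∀ x ∈ a, ∃ s, s ∈ closedBall x τ ∩ S)
    (hC2 : ∀ s ∈ S, s ∈ closedBall (0 : EuclideanSpace ℝ (Fin 3)) Rc → ∃ x ∈ a, s ∈ closedBall x τ)
    {N : ℕ} {y : Fin N → EuclideanSpace ℝ (Fin 3)} {i k : Fin N} {p p' x₁ z₁ : EuclideanSpace ℝ (Fin 3)} {R ρ ε' σ d₁ : ℝ}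
    (hsepY : ∀ a b : Fin N, a ≠ b → (7 : ℝ) / 10 ≤ dist (y a) (y b))
    (hm1 : ∀ s ∈ S, dist s p ≤ R → ∃ b : Fin N, dist (y b - y i) (s - p) ≤ ε')
    (hm2 : ∀ b : Fin N, dist (y b) (y i) ≤ R → ∃ s ∈ S, dist (y b - y i) (s - p) ≤ ε')
    (hp' : p' ∈ S) (hk : dist (y k - y i) (p' - p) ≤ ε') (hkρ : dist (y k) (y i) ≤ ρ)
    (hx₁ : x₁ ∈ a) (hp'x : p' ∈ closedBall x₁ τ)
    (hz₁ : z₁ ∈ a) (hz₁ne : z₁ ≠ x₁) (hz₁d : dist z₁ x₁ ≤ d₁)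
    (hσ : 0 < σ) (h2ε : 2 * ε' < δ) (h4ε : 4 * ε' ≤ σ)
    (hR : 13 / 10 * (d₁ + 2 * τ + 2 * ε') + (d₁ + 2 * τ + 2 * ε') + ρ + 1 ≤ R) (hR' : d₁ + 2 * τ + ρ + ε' ≤ R)
    (hRc : ‖x₁‖ + τ + 9 / 8 * (d₁ + 2 * τ + 2 * ε') + σ ≤ Rc)
    (hbad_fcc : ∀ dk : ℝ, (7 : ℝ) / 10 ≤ dk → ∀ A : EuclideanSpace ℝ (Fin 3) →ₗᵢ[ℝ] EuclideanSpace ℝ (Fin 3),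
      ¬ ((∀ u ∈ fccKissingPattern, ∃ z ∈ a, dist (z - x₁) (dk • A u) ≤ dk / 8 + σ + 2 * τ) ∧
          (∀ z ∈ a, z ≠ x₁ → dist z x₁ + σ + 4 * τ ≤ 13 / 10 * dk →
            ∃ u ∈ fccKissingPattern, dist (z - x₁) (dk • A u) ≤ dk / 8 + σ + 2 * τ)))
    (hbad_hcp : ∀ dk : ℝ, (7 : ℝ) / 10 ≤ dk → ∀ A : EuclideanSpace ℝ (Fin 3) →ₗᵢ[ℝ] EuclideanSpace ℝ (Fin 3),
      ¬ ((∀ u ∈ hcpKissingPattern, ∃ z ∈ a, dist (z - x₁) (dk • A u) ≤ dk / 8 + σ + 2 * τ) ∧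
          (∀ z ∈ a, z ≠ x₁ → dist z x₁ + σ + 4 * τ ≤ 13 / 10 * dk →
            ∃ u ∈ hcpKissingPattern, dist (z - x₁) (dk • A u) ≤ dk / 8 + σ + 2 * τ))) :
    ¬ Gy (1 / 8) N y k := by
  intro hG
  dsimp only [Gy] at hG
  obtain ⟨A, hA⟩ := hG
  set dk : ℝ := sInf ((fun z => dist z (y k)) '' (Set.range y \ {y k})) with hdk
  have hε'0 : 0 ≤ ε' := le_trans dist_nonneg hk
  have hxp : dist x₁ p' ≤ τ := by rw [dist_comm]; exact mem_closedBall.mp hp'x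
  -- a-priori bound on the shell scale of `k`: the template neighbour's atom is matched to a site of `y` near `y k`
  have hB : dk ≤ d₁ + 2 * τ + 2 * ε' := by
    obtain ⟨s₁, hs₁z, hs₁⟩ := hC1 z₁ hz₁
    have hs₁p' : dist s₁ p' ≤ d₁ + 2 * τ := by
      have h1 := dist_triangle4 s₁ z₁ x₁ p'
      have h2 : dist s₁ z₁ ≤ τ := mem_closedBall.mp hs₁z
      linarith
    have hs₁ne : s₁ ≠ p' := by
      intro h
      have h1 : dist z₁ x₁ ≤ τ + τ := by
        have h2 := dist_triangle z₁ s₁ x₁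
        have h3 : dist z₁ s₁ ≤ τ := by rw [dist_comm]; exact mem_closedBall.mp hs₁z
        have h4 : dist s₁ x₁ ≤ τ := by rw [h]; exact mem_closedBall.mp hp'x
        linarith
      have := ha z₁ hz₁ x₁ hx₁ hz₁ne
      linarith
    have hp'p : dist p' p ≤ ρ + ε' := by
      have h1 : ‖(p' - p) - (y k - y i)‖ ≤ ε' := by rw [← dist_eq_norm, dist_comm]; exact hk
      calc dist p' p = ‖(y k - y i) + ((p' - p) - (y k - y i))‖ := by rw [dist_eq_norm]; congr 1; abel
        _ ≤ ‖y k - y i‖ + ‖(p' - p) - (y k - y i)‖ := norm_add_le _ _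
        _ ≤ ρ + ε' := add_le_add (by rw [← dist_eq_norm]; exact hkρ) h1
    have hs₁p : dist s₁ p ≤ R := by
      have := dist_triangle s₁ p' p
      linarith
    obtain ⟨b, hb⟩ := hm1 s₁ hs₁ hs₁p
    have hbk : dist (y b) (y k) ≤ dist s₁ p' + 2 * ε' := by
      have h1 : dist (y b) (y k) = dist (y b - y i) (y k - y i) := by
        rw [dist_eq_norm, dist_eq_norm]; congr 1; abel
      rw [h1]
      have h2 := dist_triangle4 (y b - y i) (s₁ - p) (p' - p) (y k - y i)
      have h3 : dist (s₁ - p) (p' - p) = dist s₁ p' := by rw [dist_eq_norm, dist_eq_norm]; congr 1; abel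
      rw [dist_comm (p' - p) (y k - y i)] at h2
      linarith
    have hne : y b ≠ y k := by
      intro h
      have h1 : dist (y b - y i) (y k - y i) = 0 := by rw [h, dist_self]
      have h2 := dist_triangle4 (s₁ - p) (y b - y i) (y k - y i) (p' - p)
      have h3 : dist (s₁ - p) (p' - p) = dist s₁ p' := by rw [dist_eq_norm, dist_eq_norm]; congr 1; abel
      rw [dist_comm (s₁ - p) (y b - y i), h1, h3] at h2
      have h4 := hS s₁ hs₁ p' hp' hs₁ne
      linarith
    have hDbdd : BddBelow ((fun z => dist z (y k)) '' (Set.range y \ {y k})) :=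
      ⟨0, by rintro c ⟨z, -, rfl⟩; exact dist_nonneg⟩
    have h1 : dk ≤ dist (y b) (y k) := hdk ▸ csInf_le hDbdd ⟨y b, ⟨⟨b, rfl⟩, hne⟩, rfl⟩
    linarith
  -- transport of the engine's soft shell data from `(S, p')` to the template `(a, x₁)`
  have transport : ∀ {Pat : Finset (EuclideanSpace ℝ (Fin 3))}, (7 : ℝ) / 10 ≤ dk →
      (∀ u ∈ Pat, ∃ s ∈ S, dist (s - p') (dk • A u) ≤ dk / 8 + σ) →
      (∀ s ∈ S, s ≠ p' → dist s p' + σ ≤ 13 / 10 * dk → ∃ u ∈ Pat, dist (s - p') (dk • A u) ≤ dk / 8 + σ) →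
      (∀ u ∈ Pat, ‖u‖ = 1) →
      (∀ u ∈ Pat, ∃ z ∈ a, dist (z - x₁) (dk • A u) ≤ dk / 8 + σ + 2 * τ) ∧
        (∀ z ∈ a, z ≠ x₁ → dist z x₁ + σ + 4 * τ ≤ 13 / 10 * dk →
          ∃ u ∈ Pat, dist (z - x₁) (dk • A u) ≤ dk / 8 + σ + 2 * τ) := by
    intro Pat hdk7 hsoft₁ hsoft₂ hPatn
    have hdkpos : 0 < dk := by linarith
    refine ⟨fun u hu => ?_, fun z hz hzne hzd => ?_⟩
    · obtain ⟨s, hs, hsu⟩ := hsoft₁ u hu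
      have hnu : ‖dk • A u‖ = dk := by
        rw [norm_smul, LinearIsometry.norm_map, hPatn u hu, mul_one, Real.norm_eq_abs, abs_of_pos hdkpos]
      have hsp' : dist s p' ≤ dk + (dk / 8 + σ) := by
        have h1 := dist_triangle (s - p') (dk • A u) 0
        rw [dist_zero_right, dist_zero_right, hnu, ← dist_eq_norm] at h1
        linarith
      have hswin : s ∈ closedBall (0 : EuclideanSpace ℝ (Fin 3)) Rc := by
        rw [mem_closedBall, dist_zero_right]
        have h1 := dist_triangle4 s p' x₁ (0 : EuclideanSpace ℝ (Fin 3))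
        rw [dist_zero_right, dist_zero_right, dist_comm p' x₁] at h1
        linarith
      obtain ⟨z, hz, hsz⟩ := hC2 s hs hswin
      refine ⟨z, hz, ?_⟩
      have h1 := dist_triangle (z - x₁) (s - p') (dk • A u)
      have h2 : dist (z - x₁) (s - p') ≤ τ + τ :=
        (dist_sub_sub_le z x₁ s p').trans (add_le_add (by rw [dist_comm]; exact mem_closedBall.mp hsz) hxp)
      linarith
    · obtain ⟨s, hsz, hs⟩ := hC1 z hz
      have hsne : s ≠ p' := by
        intro h
        have h1 : dist z x₁ ≤ τ + τ := by
          have h2 := dist_triangle z s x₁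
          have h3 : dist z s ≤ τ := by rw [dist_comm]; exact mem_closedBall.mp hsz
          have h4 : dist s x₁ ≤ τ := by rw [h]; exact mem_closedBall.mp hp'x
          linarith
        have := ha z hz x₁ hx₁ hzne
        linarith
      have hsp' : dist s p' + σ ≤ 13 / 10 * dk := by
        have h1 := dist_triangle4 s z x₁ p'
        have h2 : dist s z ≤ τ := mem_closedBall.mp hsz
        linarith
      obtain ⟨u, hu, hsu⟩ := hsoft₂ s hs hsne hsp'
      refine ⟨u, hu, ?_⟩
      have h1 := dist_triangle (z - x₁) (s - p') (dk • A u)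
      have h2 : dist (z - x₁) (s - p') ≤ τ + τ :=
        (dist_sub_sub_le z x₁ s p').trans (add_le_add (by rw [dist_comm]; exact mem_closedBall.mp hsz) hxp)
      linarith
  rcases hA with ⟨e, he⟩ | ⟨e, he⟩
  · obtain ⟨hdk7, -, hsoft₁, hsoft₂⟩ := FrustratedLawDichotomyTextureFineShells.shell_transfer_core hS hsepY hm1 hm2 hp' hk hkρ
      hσ h2ε h4ε hdk hB hR FrustratedLawDichotomyTextureFineShells.fccKissingPattern_nonempty e he
    exact hbad_fcc dk hdk7 A (transport hdk7 hsoft₁ hsoft₂ fun u hu => norm_eq_one_of_mem_fccKissingPattern hu)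
  · obtain ⟨hdk7, -, hsoft₁, hsoft₂⟩ := FrustratedLawDichotomyTextureFineShells.shell_transfer_core hS hsepY hm1 hm2 hp' hk hkρ
      hσ h2ε h4ε hdk hB hR FrustratedLawDichotomyTextureFineShells.hcpKissingPattern_nonempty e he
    exact hbad_hcp dk hdk7 A (transport hdk7 hsoft₁ hsoft₂ fun u hu => norm_eq_one_of_mem_hcpKissingPattern hu)

/-- ★ **(FLIP), BAD verdict on the whole `ρ`-ball — the `hflip` shape with `R' := 0`, bad case.**  If every template site `x` with
`‖x‖ ≤ ‖p‖ + ρ + ε' + τ` is bad with margin in the soft form of `not_gy_eighth_of_badTemplate` (with a template neighbour at distance `≤ d₁`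
resolving `R` and the window), then NO site of `y` within `ρ` of `y i` is `1/8`-good. [folklore] -/
theorem forall_not_gy_eighth_of_uniformBadTemplate
    {S : Set (EuclideanSpace ℝ (Fin 3))} {δ : ℝ} (hS : ∀ x ∈ S, ∀ x' ∈ S, x ≠ x' → δ ≤ dist x x')
    {a : Finset (EuclideanSpace ℝ (Fin 3))} {τ Rc : ℝ} (hτ : 0 ≤ τ)
    (ha : ∀ z ∈ a, ∀ z' ∈ a, z ≠ z' → 2 * τ < dist z z')
    (hC1 : ∀ x ∈ a, ∃ s, s ∈ closedBall x τ ∩ S)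
    (hC2 : ∀ s ∈ S, s ∈ closedBall (0 : EuclideanSpace ℝ (Fin 3)) Rc → ∃ x ∈ a, s ∈ closedBall x τ)
    {N : ℕ} {y : Fin N → EuclideanSpace ℝ (Fin 3)} {i : Fin N} {p : EuclideanSpace ℝ (Fin 3)} {R ρ ε' σ : ℝ}
    (hsepY : ∀ a b : Fin N, a ≠ b → (7 : ℝ) / 10 ≤ dist (y a) (y b))
    (hm1 : ∀ s ∈ S, dist s p ≤ R → ∃ b : Fin N, dist (y b - y i) (s - p) ≤ ε')
    (hm2 : ∀ b : Fin N, dist (y b) (y i) ≤ R → ∃ s ∈ S, dist (y b - y i) (s - p) ≤ ε')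
    (hρR : ρ ≤ R) (hρRc : ‖p‖ + ρ + ε' ≤ Rc)
    (hσ : 0 < σ) (h2ε : 2 * ε' < δ) (h4ε : 4 * ε' ≤ σ)
    (hbad : ∀ x ∈ a, ‖x‖ ≤ ‖p‖ + ρ + ε' + τ → ∃ (z₁ : EuclideanSpace ℝ (Fin 3)) (d₁ : ℝ), z₁ ∈ a ∧ z₁ ≠ x ∧ dist z₁ x ≤ d₁ ∧
      13 / 10 * (d₁ + 2 * τ + 2 * ε') + (d₁ + 2 * τ + 2 * ε') + ρ + 1 ≤ R ∧ d₁ + 2 * τ + ρ + ε' ≤ R ∧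
      ‖x‖ + τ + 9 / 8 * (d₁ + 2 * τ + 2 * ε') + σ ≤ Rc ∧
      (∀ dk : ℝ, (7 : ℝ) / 10 ≤ dk → ∀ A : EuclideanSpace ℝ (Fin 3) →ₗᵢ[ℝ] EuclideanSpace ℝ (Fin 3),
        ¬ ((∀ u ∈ fccKissingPattern, ∃ z ∈ a, dist (z - x) (dk • A u) ≤ dk / 8 + σ + 2 * τ) ∧
            (∀ z ∈ a, z ≠ x → dist z x + σ + 4 * τ ≤ 13 / 10 * dk →
              ∃ u ∈ fccKissingPattern, dist (z - x) (dk • A u) ≤ dk / 8 + σ + 2 * τ))) ∧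
      (∀ dk : ℝ, (7 : ℝ) / 10 ≤ dk → ∀ A : EuclideanSpace ℝ (Fin 3) →ₗᵢ[ℝ] EuclideanSpace ℝ (Fin 3),
        ¬ ((∀ u ∈ hcpKissingPattern, ∃ z ∈ a, dist (z - x) (dk • A u) ≤ dk / 8 + σ + 2 * τ) ∧
            (∀ z ∈ a, z ≠ x → dist z x + σ + 4 * τ ≤ 13 / 10 * dk →
              ∃ u ∈ hcpKissingPattern, dist (z - x) (dk • A u) ≤ dk / 8 + σ + 2 * τ)))) :
    ∀ k : Fin N, dist (y k) (y i) ≤ ρ → ¬ Gy (1 / 8) N y k := by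
  intro k hkρ
  obtain ⟨p', hp', hk⟩ := hm2 k (hkρ.trans hρR)
  have hp'p : dist p' p ≤ ρ + ε' := by
    have h1 : ‖(p' - p) - (y k - y i)‖ ≤ ε' := by rw [← dist_eq_norm, dist_comm]; exact hk
    calc dist p' p = ‖(y k - y i) + ((p' - p) - (y k - y i))‖ := by rw [dist_eq_norm]; congr 1; abel
      _ ≤ ‖y k - y i‖ + ‖(p' - p) - (y k - y i)‖ := norm_add_le _ _
      _ ≤ ρ + ε' := add_le_add (by rw [← dist_eq_norm]; exact hkρ) h1
  have hp'n : ‖p'‖ ≤ ‖p‖ + dist p' p := by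
    have := norm_add_le p (p' - p)
    rwa [add_sub_cancel, ← dist_eq_norm] at this
  have hp'win : p' ∈ closedBall (0 : EuclideanSpace ℝ (Fin 3)) Rc := by
    rw [mem_closedBall, dist_zero_right]; linarith
  obtain ⟨x₁, hx₁, hp'x⟩ := hC2 p' hp' hp'win
  have hx₁n : ‖x₁‖ ≤ ‖p‖ + ρ + ε' + τ := by
    have h1 : dist p' x₁ ≤ τ := mem_closedBall.mp hp'x
    have h2 : ‖x₁‖ ≤ ‖p'‖ + dist p' x₁ := by
      have := norm_sub_le p' (p' - x₁)
      rwa [sub_sub_cancel, ← dist_eq_norm] at this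
    linarith
  obtain ⟨z₁, d₁, hz₁, hz₁ne, hz₁d, hR, hR', hRc, hbf, hbh⟩ := hbad x₁ hx₁ hx₁n
  exact not_gy_eighth_of_badTemplate hS hτ ha hC1 hC2 hsepY hm1 hm2 hp' hk hkρ hx₁ hp'x hz₁ hz₁ne hz₁d hσ h2ε h4ε hR hR' hRc hbf hbh

end Summit.AtomisticToContinuum.Crystallization.Theorems.FrustratedLawDichotomyTextureFlipBad

end
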